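import Summits.FinalStateConjecture.FinalStateConjecture.Theses.BartnikGapSettling
import Summits.FinalStateConjecture.FinalStateConjecture.Theorems.BartnikGapSettlingBondiBartnikRigidityTrivialRegime
import Summits.FinalStateConjecture.FinalStateConjecture.Theorems.BondiBartnikRigidity.Negative.BondiBartnikRigidityFalseOfBlindCollapsedLeaf
import Summits.FinalStateConjecture.FinalStateConjecture.Theorems.BartnikGapSettlingBondiBartnikRigidityDirectMethodDefs
import Summits.FinalStateConjecture.FinalStateConjecture.Theorems.BartnikGapSettlingBondiBartnikRigidityDirectMethodLeafDefs
import Summits.FinalStateConjecture.FinalStateConjecture.Theorems.BartnikGapSettlingBondiBartnikRigidityKillingDomainCausal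
import Summits.FinalStateConjecture.FinalStateConjecture.Theorems.BartnikGapSettlingBondiBartnikRigidityStationaryKerrCollarRoute
import Summits.FinalStateConjecture.FinalStateConjecture.Theorems.BartnikGapSettlingBondiBartnikRigidityStationaryKerrCollarRouteOriented
import Summits.FinalStateConjecture.FinalStateConjecture.Theorems.BartnikGapSettlingBondiBartnikRigiditySlabCauchyRigidityDefs
import Summits.FinalStateConjecture.FinalStateConjecture.Theorems.BartnikGapSettlingBondiBartnikRigidityKerrLateBoxPlacement
import Summits.FinalStateConjecture.FinalStateConjecture.Theorems.BartnikGapSettlingBondiBartnikRigidityRouteMarchingDefs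
import Summits.FinalStateConjecture.FinalStateConjecture.Theorems.BartnikGapSettlingBondiBartnikRigiditySlabCauchyRigidity
import Summits.FinalStateConjecture.FinalStateConjecture.Theorems.BartnikGapSettlingBondiBartnikRigiditySlabFutureContainsCylinder
import Summits.FinalStateConjecture.FinalStateConjecture.Theorems.BartnikGapSettlingBondiBartnikRigiditySlabFrontier
import Summits.FinalStateConjecture.FinalStateConjecture.Theorems.BartnikGapSettlingBondiBartnikRigidityExactChartGluing
import Summits.FinalStateConjecture.FinalStateConjecture.Theorems.BartnikGapSettlingBondiBartnikRigidityExactChartPastSet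
import Summits.FinalStateConjecture.FinalStateConjecture.Theorems.BartnikGapSettlingBondiBartnikRigidityMarchingLemma
import Summits.FinalStateConjecture.FinalStateConjecture.Theorems.BartnikGapSettlingBondiBartnikRigidityOuterBoundaryCollarChartDefs
import Literature.Geometry.Lorentzian.BondiBartnikGap
import Literature.Geometry.Lorentzian.NearKerrCollarCore
import Literature.Geometry.Lorentzian.SoundNearKerrLeaf
import Literature.Geometry.Lorentzian.KillingHorizonShadowAlong
import Literature.Geometry.Lorentzian.CausalFutureProofs
import Literature.Geometry.Lorentzian.DeviationTolerance

/-!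
# Line `direct-method-on-the-cone` for crux `BondiBartnikRigidity` (stmt-FinalStateConjecture-10807)
# — skeleton rev 7 (lead c3: F1' + five marching inputs LANDED; K2a ↦ K2a' (diamond form, Defs landed); K1a ↦ K1a';
# K3/K4/probe typed reductions LANDED)

Crux-plan skeleton (planner, 2026-08-16) for the idea card
`Cruxes/BondiBartnikRigidity/Ideas/direct-method-on-the-cone.md` (triage r2: 2/2 pass), line card
`Lines/direct-method-on-the-cone.md`; RESHAPED by the line lead a2 after wave 1 (four worker verdicts,
reports attached to the crux item as `K2-report-a2.md`, `K3-report-a2.md`, `K4-report-a2.md`,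
`Probe-report-a2.md`).  What changed against rev 1 (sha 6ee9462ad2aa):

* the local vocabulary moved VERBATIM to Theorems and is imported:
  `…Theorems/BartnikGapSettlingBondiBartnikRigidityDirectMethodDefs.lean` (p130340: `coordBox`,
  `IsNearModelBox`, `shellSlab`, `futureDomain`, `killingDomain`, `ExactMinimiserKerrness`),
  `…DirectMethodLeafDefs.lean` (p132278: `IsPinnedSoundNearKerrLeaf`), `…KillingDomainCausal.lean`
  (`killingDomain ⊆ J⁺(C)`, degenerate/exact boxes), `…StationaryKerrCollarRoute.lean` (Kerr-side sets,
  `IsRoofChart`, the three K2 route statements and the checked reduction `K2Route.K2_of_route`);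
* K2 `stub_stationaryKerrCollarExtension` is NO LONGER A STUB: it is proved here from the three
  registered route stubs `stub_outerRoofChart` (F4', OPEN — where K2's difficulty lives: one-sided
  control of `ξ` near the outer roof outside the exact diamond), `stub_roofDevelopmentExtension` (F5,
  Rendall-type Cauchy–characteristic uniqueness + maximality, MISSING in tree, true on paper) and
  `stub_kerrLateBoxPlacement` (F6, pure Kerr causal geometry in the star chart, CLOSABLE), by
  `K2Route.K2_of_route` (worker K2, wave 1; typing audit of K2 passed);
* K3 `stub_compactnessToKerrInterior` and K4 `stub_farCompletion` are RE-TYPED ON THE HYPOTHESIS SIDE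
  (worker verdicts `stub-misstated` K3 / `stub-blocked` + frame finding K4): the hypothesis leaf is a
  PINNED SOUND leaf (`IsPinnedSoundNearKerrLeaf` = `IsSoundNearKerrLeaf` block + (S₆) tip pinning —
  without it far-tipped sheets, null to `O(L⁻²)` over the hole, let gap-affordable focused incoming
  trains spoil every Kerr box up to collar time `→ ∞`, so no uniform-compactum argument applies), and
  the collar chart is presented in the hole's REST FRAME, `(mo 0).1 = 1` (component certification is
  frame-dependent and `(mo i).1 ∈ lorentzGroup` is unbounded and quantified after every tolerance:
  boost-hiding of null-aligned content makes the `δ`-collar / `(ε₁,k₁)`-box interface idle; already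
  exact Kerr presented with rapidity `β`, `e^{2β} > εR/4M`, kills the card's far-chart step).  Both are
  HYPOTHESIS-side restatement requests to the tenure planner (TRIAGE-r2-2 item (ii) and worker K4 §5),
  in addition to C″ (`Λ < 1`, `N ≤ 1`, `p ∈` collar) and SOUND conclusion leaves;
* accordingly the flagged `stub_filedTextResidue` gains a fourth sector — `N = 1` instances whose
  hypothesis leaf is not pinned-sound at the working regularity or whose collar chart is not rest-frame
  — and is now stated for all sufficiently large `k'` (`∃ k₀ ∀ k' ≥ k₀`) so that the composition can
  hand it the negated pinned clause at its own regularity; it remains junk-TRUE on paper (dodging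
  leaves + fake holes), Lean-undecidable, never staffed, and deleted by the restatement iff the
  restatement adopts the two hypothesis-side repairs above;
* K1 `stub_exactMinimiserStationary` is SPLIT into F1 `stub_slabCauchyRigidity` (exact slab jet ⇒ exact
  inner-diamond chart inside the interior of the Killing domain: LOCAL vacuum uniqueness + localisation,
  formalisable with the tree's common-development machinery and the named fact
  `hawkingEllis_locallyUnique_vacuumDevelopment`; shared ingredient of K2a) and K1a
  `stub_exactMinimiserKilling` (the OPEN core: a Killing field on the interior of the Killing domain
  extending `dΨ(∂_{t*})` of the exact diamond), and PROVED from them here; the foreign `stub_probeSector`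
  is unchanged (K1/K2/`ExactMinimiserKerrness` live in the LIMIT CATEGORY — exact collar, no hypothesis
  leaf — and are unaffected by the hypothesis-side defects; the probe sector is blocked on B1 `ProbeBartnikMassZero` +
  `ConeEnergyPinchesFlatSound`, both unprinted, and is VACUOUS in every black-hole-forming development
  by the sharpened Defect B′ of `Probe-report-a2.md`).

rev 3 (after wave 2: F6 `KerrLateBoxPlacement` LANDED p138848; F1 `stub-misstated` and F5 `stub-false` —
the limit-category block was ORIENTATION-BLIND (time-reversed exact Kerr / Schwarzschild meets every
hypothesis, `J⁺(C)`-placed conclusions fail) and, for `a ≠ 0`, the slope-1 diamond is not in `D⁺_Kerr(slab)`;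
cured by the orientation clauses `CollarFutureOriented`/`CollarTimeOriented` and the diamond `Δ'`
(`Theorems/…StationaryKerrCollarRouteOriented.lean`, `…SlabCauchyRigidityDefs.lean`); the corrected F1' is
PROVED sorry-free by worker F1 modulo `choquetBruhat_geroch_exists_mghd_cauchy`, landing in progress).
Stubs of rev 3 (9 sorries): `stub_mghdExistence` (named fact, debt), F1' `stub_slabCauchyRigidity'`
(proved, landing), K1a `stub_exactMinimiserKilling` (XL, open; lead), K2a
`stub_outerBoundaryCollarChart` (XL, open), K2b `stub_roofDevelopmentExtensionCollar` (L, marching), K3 `stub_compactnessToKerrInterior` (XL; honest route =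
`LeafCompactness` + `CutEnergyLSC` + `CompetitorRealisation` + `BoxTransfer` + EMK, typed and composed
sorry-free in `K3-report-a2`), K4 `stub_farCompletion` (XL; = F1 recentring (proved) + F2ʳ
`FarHyperboloidalCompletionRest`, Klainerman–Nicolò-type relative to Kerr, unprinted), `stub_probeSector`
(XL, foreign), `stub_filedTextResidue` (flagged, never staffed).

rev 5/6 (lead c3, 2026-08-17, waves 1–2): SIX registered stubs LANDED as Theorems — F1' `stub_slabCauchyRigidity'`
(p144449 + 9 bricks), `stub_slabFutureContainsCylinder` (p145656), `stub_slabFrontier` (p148120 + 2 bricks),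
`stub_exactChartGluing` (p149029), `stub_exactChartPastSet` (p149753), `stub_marchingLemma` (p160410 + 25 bricks) —
so the corrected F5 `K2Route.RoofDevelopmentExtensionCollar` is PROVED modulo only `choquetBruhat_geroch_exists_mghd_cauchy`;
K2a `stub_outerBoundaryCollarChart` was MIS-STATED (false by the `ξ ↦ −ξ` symmetry of its box-form hypothesis,
worker K2a) and is RESHAPED to the diamond form `stub_outerBoundaryCollarChart' : K2Route.OuterBoundaryCollarChartOriented'`
with the corrected glue `K2Route.K2Oriented'_of_routeCollar` and the direct plumbing F1' ⊕ K1a ⟹ K2' (the box-form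
oriented K1 is gone).  Stubs of rev 6 (7 sorries): `stub_mghdExistence` (named fact, XL debt), K1a
`stub_exactMinimiserKilling` (XL, open; lead), K2a' `stub_outerBoundaryCollarChart'` (XL, open; typed route F3'/F4a'/F4b'/RoofReach
checked), K3 `stub_compactnessToKerrInterior`, K4 `stub_farCompletion`, `stub_probeSector` (XL, parked on unprinted
facts), `stub_filedTextResidue` (flagged, never staffed).

## The lever (unchanged)

Read `∃ k' ∀ Λ < 1 ∃ δ γ ∀ instances` as: failure ⇒ a MINIMISING SEQUENCE WITH A PRIORI BOUNDS for the
Bondi–Bartnik problem of a thick Kerr collar; extract an EXACT minimiser with EXACT collar (compactness +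
semicontinuity, K3), whose Euler–Lagrange equation on the free characteristic data of the outer roof is a
characteristic KID condition for the Killing candidate transported from the Kerr jet (K1); a Killing
development through an exact thick Kerr collar is Kerr on the Killing domain (K2 = F4' ∘ F5 ∘ F6); Cauchy
stability on compacta and the far engine (K4) transfer `(ε, k)`-structure back — contradiction.

Composition `BondiBartnikRigidity_of` is pure logic (sorry-free outside the stubs): `k'` = max of the
stubs' counts; `δ, γ` = minima at the given `Λ`; regimes `Λ ≤ ε` (landed trivial regime p103152) /
`ε < Λ < 1` by cases `N = 0` (foreign) · `N = 1, p ∈ collar, pinned-sound hypothesis leaf, rest-frame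
collar` (THIS LINE: K3 fed `exactMinimiserKerrness_of_stubs` = K1 ∘ K2 at the box parameters K4 asked
for; K4 ⇒ sound leaf `⊆ J⁺(C) ⊆ J⁺(S)`; sound ⇒ typed) · else residue / `1 ≤ Λ` residue.

Disproof used: no `Disproof.lean` exists for this crux (payload.disproof_path absent on this hub,
`ledger crux ls`, 2026-08-16T23Z); the landed Negative lemma
`Theorems/BondiBartnikRigidity/Negative/BondiBartnikRigidityFalseOfBlindCollapsedLeaf.lean` is imported
and honoured (bears only on the residue, modulo its unsupported `H`).  Negatives index: 1 unrelated entry.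
-/

noncomputable section

-- D-0017: single-problem summit, `Summit.<S>.<S>.…` by design (cf. lakefile `weak.linter.dupNamespace`).
set_option linter.dupNamespace false

open Set Filter Function Topology TopologicalSpace
open Literature.Geometry.Lorentzian
open Summit.FinalStateConjecture.FinalStateConjecture.Theorems.BondiBartnikRigidity.DirectMethod
open scoped Manifold ContDiff Topology ENNReal BigOperators

namespace Summit.FinalStateConjecture.FinalStateConjecture.Cruxes.BondiBartnikRigidity.DirectMethodOnTheCone

/-! ## Stubs in the limit category (arbitrary vacuum data; exact collar; exact minimiser) -/

/-! ### K1 — exact Bondi–Bartnik minimisers with an exact, FUTURE-ORIENTED thick Kerr collar are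
stationary on the Killing domain: F1' (slab-jet Cauchy rigidity, corrected; PROVED by worker F1 modulo the
named fact `choquetBruhat_geroch_exists_mghd_cauchy`, landing in progress) + K1a (the Killing field: the OPEN
core), glued below.  rev 3: orientation clauses and the corrected diamond `Δ' = {0 < t*, 3t* + 2r < 6M}`. -/

/-- **MGHD EXISTENCE** (Choquet-Bruhat–Geroch 1969, Thm 3 — the tree's named fact
`choquetBruhat_geroch_exists_mghd_cauchy`, `Literature/Geometry/Lorentzian/CauchyProblemMGHDExistence.lean`):
every smooth vacuum initial data set on a connected Hausdorff second countable `3`-manifold solving the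
constraints has a maximal vacuum Cauchy development.  The ONE unproved published fact on which the corrected
F1' (and, on paper, the corrected F5) rests; a formalisation debt (quasilinear hyperbolic PDE theory), TRUE.
Isolated as its own stub so that the dependency is visible and F1' lands as a proved conditional.  Size: XL
as a formalisation.  Sources: ChoquetBruhatGeroch1969CMP Thm 3, Ringstrom2009 Thm 14.2/16.6, Sbierski2016AHP. -/
theorem stub_mghdExistence : choquetBruhat_geroch_exists_mghd_cauchy := by
  sorry

/-! **F1' — VACUUM CAUCHY RIGIDITY OF THE EXACT, FUTURE-ORIENTED THICK SLAB** (`F1Route.SlabCauchyRigidity'`):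
LANDED (lead c3, wave 1, worker W1): `Theorems/BartnikGapSettlingBondiBartnikRigiditySlabCauchyRigidity.lean` (p144449; 9 brick
modules p141552 p141854 p142216 p142221 p142772 p142774 p142775 p143159 p144121), sorry-free modulo ONLY the named fact
`choquetBruhat_geroch_exists_mghd_cauchy`; the bare name `stub_slabCauchyRigidity'` below now resolves to the landed
`…Theorems.BondiBartnikRigidity.DirectMethod.stub_slabCauchyRigidity'`. -/

/-- **K1a' — EXACT BONDI–BARTNIK MINIMISERS WITH AN EXACT, FUTURE-ORIENTED THICK KERR COLLAR CARRY A KILLING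
FIELD ON THE KILLING DOMAIN EXTENDING THE KERR-STAR TIME TRANSLATION OF THE EXACT DIAMOND** (the load-bearing
OPEN stub; Euler–Lagrange on the cone; rev 3: the two orientation clauses `K2Route.CollarFutureOriented`,
`K2Route.CollarTimeOriented` and the corrected diamond `F1Route.slabDiamond'`; rev 7: F1''s continuity clause
`ContinuousOn Ψ slabDiamondWithSlab'` is KEPT as a hypothesis — the ATTACHMENT of the diamond chart to the collar is
what makes the printed half of the stub true (worker beta); typed split K1a' ⟸ α `K1aRoute.MinimiserKillingGerm`
(unprinted Euler–Lagrange/characteristic-KID germ near `C ∪ N_out`) ∘ β' `K1aRoute.KillingPropagation'`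
(Moncrief/FMM Killing development + HE §6.6 + Killing rigidity), composition checked in
`Lines/direct_method_on_the_cone_K1a.lean`; β' registered as helper stub `stub_killingPropagation'`).  Let `𝒱` be a vacuum Cauchy
development of arbitrary smooth data, maximal among developments of its data, carrying ONE thick collar
chart `Φ 0` with EXACT Kerr `k'`-jet on the slab `{t* = 0, M < r ≤ 3M}`, FUTURE-ORIENTED, whose core `C`
(`p ∈ C`; `C ⊆ ι X`) has a cut Bondi energy and Bondi–Bartnik gap `≤ 0` against admissible competitors and at
least ONE competitor; and let `Ψ` be the exact diamond chart of F1' on `Δ'` (agreeing with `Φ 0` on the slab,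
smooth open embedding of `Δ'` into the interior of the Killing domain, deviation `0`).  Then `𝒱` carries a
vector field `ξ`, Killing on the interior of `killingDomain = D⁺(C ∪ N_out)`, which on `Ψ(Δ')` is the
push-forward of `∂_{t*} = Λ e₀`.  Intended proof (card; triage r2): the cut energy is the functional
`𝔅[χ̂; jet]` of the FREE characteristic data of the outer roof; minimality + competitor REALISATION ⇒
`d𝔅[δχ̂] = 0`; the Hamiltonian flux identity on `N_out` with corner at `S₃` and end at `𝓘⁺` turns criticality
into the tangential KID equations for the candidate `(ξ, ∇ξ)` TRANSPORTED from the exact Kerr jet at `S₃`;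
Chruściel–Paetz arXiv:1305.7468 Thm 1.2 on `N̲ ∪ N_out` gives `ξ` Killing on `D⁺`.  Why it might fail: the
transported `ξ` must tend to a BMS translation at the cut; criticality only against REALISABLE variations may
miss soft directions; exhaustion of the residual KID equations by the `χ̂`-conjugate components of `𝓛_ξ g` is
unproved; linearisation at Kerr = non-degeneracy of the Hessian of `𝔅` mod gauge (falsifier #1, unrun).
Size: XL (open).  Sources: HuangLee2020 Thm 10, arXiv:1406.7480 Thm 4.8, arXiv:1305.7468 Thm 1.2,
ChruscielJezierskiLeski2004, An2020MassMinimizing. -/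
theorem stub_exactMinimiserKilling' : ∀ (k' : ℕ), 2 ≤ k' →
    ∀ (X : Type) [TopologicalSpace X] [ChartedSpace E3 X] [IsManifold (𝓡 3) ∞ X]
      [T2Space X] [SecondCountableTopology X] [ConnectedSpace X]
      (D : InitialDataSet (𝓡 3) X) (𝒱 : VacuumCauchyDevelopment D)
      (M a : Fin 1 → ℝ) (p : 𝒱.carrier) (mo : Fin 1 → lorentzGroup × E4)
      (B : Fin 1 → ModelBackground) (Φ : ∀ i, (B i).domain → 𝒱.carrier)
      (Ψ : (B 0).domain → 𝒱.carrier),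
    𝒱.IsMaximal → (∀ i, 0 < M i ∧ |a i| < M i) →
    (∃ i, p ∈ Φ i '' (B i).truncTimeSlab (3 * M i) 0) →
    collarCore M p B Φ ⊆ range 𝒱.embed →
    𝒱.NearKerrCollarCore k' 0 0 1 M a univ p mo B Φ →
    K2Route.CollarFutureOriented 𝒱 M mo B Φ → K2Route.CollarTimeOriented 𝒱 M a mo B Φ →
    (∃ m' : ℝ, 𝒱.IsCompetitorMass (collarCore M p B Φ) m') →
    (∀ x ∈ (B 0).truncTimeSlab (3 * M 0) 0, Ψ x = Φ 0 x) →
    ContinuousOn Ψ (F1Route.slabDiamondWithSlab' (B 0) (M 0)) →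
    ContMDiffOn 𝓘(ℝ, E4) (𝓡 4) ∞ Ψ (F1Route.slabDiamond' (B 0) (M 0)) →
    IsOpenEmbedding ((F1Route.slabDiamond' (B 0) (M 0)).restrict Ψ) →
    Ψ '' F1Route.slabDiamond' (B 0) (M 0) ⊆ interior (killingDomain 𝒱 M p B Φ) →
    supCkENorm (Subtype.val '' F1Route.slabDiamond' (B 0) (M 0)) 0
      (𝒱.toSpacetime.deviationExtend (B 0) Ψ) ≤ 0 →
    ∀ [𝒱.metric.toPseudoRiemannianMetric.HasLeviCivita],
    ∃ ξ : Π x : 𝒱.carrier, TangentSpace (𝓡 4) x,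
      𝒱.metric.IsKillingFieldOn ξ (interior (killingDomain 𝒱 M p B Φ)) ∧
      ∀ x ∈ F1Route.slabDiamond' (B 0) (M 0),
        ξ (Ψ x) = mfderiv 𝓘(ℝ, E4) (𝓡 4) Ψ x (((mo 0).1 : E4 ≃L[ℝ] E4) (E4.basisVector 0)) := by
  sorry

/-! ### K2 (oriented, CORRECTED — rev 6) — a Killing development through an exact, future-oriented thick Kerr
collar whose Killing field is PINNED ON THE EXACT DIAMOND is Kerr on the Killing domain (chart form): composed
from the corrected K2a' (below, OPEN), the corrected F5 `K2Route.RoofDevelopmentExtensionCollar` (LANDED by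
marching, rev 6) and the landed F6 `stub_kerrLateBoxPlacement` (p138848), by the checked glue
`K2Route.K2Oriented'_of_routeCollar`.

rev 6 (lead c3, wave 2, worker K2a — verdict `stub-misstated`, report `K2a-report-c3.md` attached to the crux
item): the rev-3/4/5 registered K2a `K2Route.OuterBoundaryCollarChartOriented` is FALSE in the intended model —
its `ξ`-normalising hypothesis is an orientation- and location-free exact shell BOX, so the hypothesis block is
invariant under `ξ ↦ −ξ` (witness: Schwarzschild MGHD of `{t* = 0, r > 0}`, `M > 1`, identity collar,
`ξ := −∂_{t*}`, box chart = late `t*`-translation ∘ static reflection on `{0 < t* < 1, 5M/2 < r < 3M}`;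
`HasCutBondiMass` by the round cone spheres, `m_H ≡ M`), while the conclusion's `ξ`-clause over
`pullK (O ∩ J⁺_K(slab)°)` integrates, through `Ψ = Φ₀` on the slab and continuity, to `t* ∘ Ψ < 0`,
contradicting `image ⊆ (killingDomain)° ⊆ J⁺(C) ⊆ {t* ≥ 0}`.  CURE = the hypothesis K1a actually delivers:
`ξ = dΨ_Δ(Λe₀)` on the corrected DIAMOND `Δ'` for the exact chart `Ψ_Δ` of F1' (agreeing with `Φ₀` on the
slab, continuous up to it) — `K2Route.OuterBoundaryCollarChartOriented'` below; the corrected K2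
`K2Route.K2Oriented'` and the plumbing F1' ⊕ K1a ⟹ K2' make the former box-form oriented K1
(`exactMinimiserStationaryOriented`, rev 3–5) unnecessary: DELETED.  The corrected statements LANDED as
`Theorems/BartnikGapSettlingBondiBartnikRigidityOuterBoundaryCollarChartDefs.lean` (p161156, lead c3) and are imported. -/

/-! (rev 7: the corrected statements `K2Route.OuterBoundaryCollarChartOriented'`, `K2Route.K2Oriented'` and the glue
`K2Route.K2Oriented'_of_routeCollar` are now IMPORTED from the landed
`Theorems/BartnikGapSettlingBondiBartnikRigidityOuterBoundaryCollarChartDefs.lean` (p161156).) -/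

/-- **K2a' — THE OUTER BOUNDARY COLLAR IS KERR, CHARTED** (`K2Route.OuterBoundaryCollarChartOriented'`, the
diamond-normalised corrected F4'; the OPEN, load-bearing step of K2; rev 6).  Under K2's hypotheses (maximal
vacuum development of arbitrary data; one exact, FUTURE-ORIENTED thick collar at order `k' ≥ 2` on the Cauchy
slice; a cut Bondi energy of the core; `ξ` Killing on the interior of the Killing domain and equal to `dΨ_Δ(Λe₀)`
on the exact DIAMOND `Δ'` of F1', `Ψ_Δ = Φ₀` on the slab and continuous up to it) there is, for every radius
`ρ`, a BOUNDARY-COLLAR CHART (`K2Route.IsBoundaryCollarChart`: ONE exact chart on the pull-back of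
`Δ½ ∪ (O ∩ J⁺_K(slab)°)`, `O ⊇` the roof portion `C⁺_K(S₃) ∩ {r ≤ ρ}`, continuous up to slab ∪ roof portion,
`= Φ₀` on the whole slab, roof portion `↦ ∂J⁺(C)`, image of the open part in `(killingDomain)°`) on which
`ξ = dΨ(Λe₀)`.  Audit (worker K2a, `K2a-report-c3.md`): not junk-true (for `ρ ≥ 3M`, `O ∋ S₃` and the
`ξ`-clause bites on vertical segments over the open slab; `E = Δ½ ∪ (O ∩ J⁺_K(slab)°)` is connected through the
corner), not junk-false any more (time reversal excluded by `CollarFutureOriented`; `ξ ↦ −ξ` excluded by the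
diamond pinning; punctured data excluded by `HasCutBondiMass` — pinned sections have divergent Hawking masses
`m_H = M√(⨍f²)⨍(1/f)`; perturbed exteriors have no Killing `ξ` on `(killingDomain)°`, which does contain
one-sided roof neighbourhoods).  Paper route (CHECKED reduction
`outerBoundaryCollarChartOriented'_of_facts : F3' → F4a' → F4b' → RoofReach → K2a'`, worker file
`work/stubs/K2a/OuterBoundaryCollarChartRoute.lean`, rc 0): F3' `TimelikeKillingKerrContinuation'` (Müller zum
Hagen analyticity `mullerZumHagen1970_analytic_of_timelikeKilling` — XL named fact, unproved in the tree — plus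
the analytic developing map, Kobayashi–Nomizu VI.6.1, image radius controlled by the Weyl invariant
`(r − ia cos θ)⁶ = 3M²/I`), F4a' `OuterRoofStationarity'` (the roof stays in the `ξ`-timelike component:
continuity of `ζ = (3M²/|I|)^{1/6}`, `≥ 3M` on the roof vs `≤ 2M` on any ergosurface — closes the former
"one-sided control" gap on paper), F4b' `RoofCollarCoherence` (local charts ⟹ one maximal boundary-collar
chart, `S₃ ⊆ O`, injectivity via `ζ`), `RoofReach` (maximal chart + `HasCutBondiMass` ⟹ every `ρ`).  Why it
might fail: only F3'/F4b' bookkeeping (monodromy on `D² × S²` is trivial); the inputs are unprinted as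
packaged and XL to formalise (MzH).  Size: XL (open in the tree; true on paper by the route).  Sources:
MullerZumHagen1970, Carter1968 §3, KobayashiNomizu1963 VI.6.1, ONeill1983 Prop. 3.62,
ChristodoulouKlainerman1993PMS41 Ch. 17, IonescuKlainerman2009. -/
theorem stub_outerBoundaryCollarChart' : K2Route.OuterBoundaryCollarChartOriented' := by
  sorry

/-! ### K2b — KERR SLAB + KERR BOUNDARY COLLAR ⟹ THE TRUNCATED CAUSAL FUTURE IS KERR
(`K2Route.RoofDevelopmentExtensionCollar`, the CORRECTED F5): LANDED (rev 6, lead c3 waves 1–2).  The landed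
reduction `stub_roofDevelopmentExtensionCollarOfMarching : MarchingLemma → RoofDevelopmentExtensionCollar`
(p139802) applied to the five marching inputs, ALL LANDED as registered: `stub_slabFutureContainsCylinder`
(p145656, `Theorems/…SlabFutureContainsCylinder.lean`), `stub_slabFrontier` (p148120, `…SlabFrontier.lean` +
bricks p147487 `…SlabFrontierCausalClocks`, p147600 `…SlabFrontierLens`), `stub_exactChartGluing` (p149029,
`…ExactChartGluing.lean`), `stub_exactChartPastSet` (p149753, `…ExactChartPastSet.lean`), `stub_marchingLemma`
(p160410, `…MarchingLemma.lean` + 25 bricks `…MarchingLemma*.lean`, p150411–p159427; the boundary collar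
chart's orientation is FORCED — `OrientK.collar_isFutureDirected` — so `CollarFutureOriented` is idle there).
The bare names below resolve to the landed `…Theorems.BondiBartnikRigidity.DirectMethod.stub_*`. -/

/-- **K2b** (`K2Route.RoofDevelopmentExtensionCollar`, the corrected F5), PROVED — modulo only the named fact
`choquetBruhat_geroch_exists_mghd_cauchy` (`stub_mghdExistence`) — from the five LANDED marching inputs by the
landed reduction `stub_roofDevelopmentExtensionCollarOfMarching` (p139802). -/
theorem roofDevelopmentExtensionCollar : K2Route.RoofDevelopmentExtensionCollar :=
  stub_roofDevelopmentExtensionCollarOfMarching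
    (stub_marchingLemma stub_slabFutureContainsCylinder (stub_slabFrontier stub_slabFutureContainsCylinder)
      stub_exactChartPastSet stub_exactChartGluing stub_mghdExistence)

/-- **K2' (oriented, corrected)** (`K2Route.K2Oriented'`), PROVED from K2a', K2b and the landed F6 by the
checked glue `K2Route.K2Oriented'_of_routeCollar`. -/
theorem stationaryKerrCollarExtensionOriented' : K2Route.K2Oriented' :=
  K2Route.K2Oriented'_of_routeCollar stub_outerBoundaryCollarChart' roofDevelopmentExtensionCollar
    stub_kerrLateBoxPlacement

/-- **F1' ⊕ K1a ⊕ K2' compose to `ExactMinimiserKerrnessOriented`** (pure logic, rev 6 plumbing of worker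
K2a: F1' (LANDED, p144449) supplies the exact diamond chart `Ψ_Δ` WITH its continuity clause, K1a the Killing
field `ξ = dΨ_Δ(Λe₀)` on `Δ'`, together exactly the `ξ`-hypothesis of `K2Route.K2Oriented'`; the Levi-Civita
standing hypothesis is discharged by `PseudoRiemannianMetric.hasLeviCivita`). -/
theorem exactMinimiserKerrnessOriented_of_stubs : ExactMinimiserKerrnessOriented := by
  intro k' hk' X _ _ _ _ _ _ D 𝒱 M a p mo B Φ hmax hpar hp hCX hcore hfut htime hcomp k R T
  haveI : 𝒱.metric.toPseudoRiemannianMetric.HasLeviCivita :=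
    𝒱.metric.toPseudoRiemannianMetric.hasLeviCivita
  -- F1' (landed): the exact diamond chart on the corrected diamond, continuous up to the slab
  obtain ⟨Ψ, hΨΦ, hc, hs, he, hJ, hd⟩ := stub_slabCauchyRigidity' stub_mghdExistence k'
    (le_trans one_le_two hk') X D 𝒱 M a p mo B Φ hmax hpar hp hcore.1 hcore.2.1 (fun i => hcore.2.2.1 i)
    hCX htime
  -- K1a: the Killing field on the interior of the Killing domain, `= dΨ(Λe₀)` on `Ψ(Δ')`
  obtain ⟨ξ, hξ, hξΨ⟩ := stub_exactMinimiserKilling' k' hk' X D 𝒱 M a p mo B Φ Ψ hmax hpar hp hCX hcore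
    hfut htime hcomp hΨΦ hc hs he hJ hd
  -- K2' (K2a' ⊕ landed K2b ⊕ landed F6)
  exact stationaryKerrCollarExtensionOriented' k' hk' X D 𝒱 M a p mo B Φ hmax hpar hp hcore.1 hcore.2.1
    (fun i => hcore.2.2.1 i) hfut hCX hcore.hasCutBondiMass ξ hξ ⟨Ψ, hΨΦ, hc, hs, he, hJ, hd, hξΨ⟩ k R T


/-! ## Stubs in the crux category (admissible MGHDs; the honest `N = 1` sector: pinned-sound hypothesis
leaf, rest-frame collar) -/

/-- **K3 — COMPACTNESS–SEMICONTINUITY–TRANSFER** (the soft package of the direct method; rev 3: consumes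
`ExactMinimiserKerrnessOriented` and carries the two collar orientation clauses), RE-TYPED on the
hypothesis side after wave 1 (worker K3 verdict `stub-misstated`; K3-report-a2): the hypothesis leaf is a
PINNED SOUND leaf (`IsPinnedSoundNearKerrLeaf`, (S₆) tip pinning) and the collar chart is rest-frame
(`(mo 0).1 = 1`, worker K4's frame finding); otherwise verbatim rev 1.  `ExactMinimiserKerrness` (K1 ∘ K2)
implies that NEAR-minimisers with NEAR-Kerr collars on such leaves have NEAR-Kerr interiors: for every
margin/window `(χ, m₀)`, box quality `(k₁, ε₁)`, radius `R`, length `T` there is `k'` such that below the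
honesty threshold some `δ, γ > 0` force an `(ε₁, k₁)`-Kerr box `{τ < t* < τ + T, M < r < R + 1}` of the
collar's own (rest-frame) background inside `J⁺(C)`.  Honest route (typed and composed sorry-free in the
worker's file, published as `Lines/direct-method-on-the-cone-K3.lean`): `LeafCompactness` (Arzelà–Ascoli on
the FIXED model layers of the pinned sound leaf + MGHD of the limit datum + CAUCHY STABILITY on compacta —
missing; parts exist: `ChartMetricCompactness`, `KerrFramedCompactness`, `VacuumLocalLimit`,
`choquetBruhat_geroch_exists_mghd_cauchy`), `CutEnergyLSC` (Hawking-mass monotonicity in the rest-frame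
round foliation — missing; vocabulary `NullHypersurface.HasHawkingFlux` exists), `CompetitorRealisation`
(USC by gluing — missing, XL), `BoxTransfer` (missing) + EMK ⇒ K3 by contradiction along a failing
sequence (`nearMinimiserShadowing_of_facts`, `stub_compactnessToKerrInterior_pinned_of_facts`, proved).
Why it might fail: (i) the limit must CARRY the cut energy (flux norm only near `𝓘⁺`); (ii) competitor
realisation is XL gluing and needs ONE admissible competitor for the exact collar (Kehle–Unger-type);
(iv) `C^k_loc` control on `J⁺(C)` beyond `D(leaf ∩ compactum)` is honest Cauchy stability only because the
pinned sound leaf shields a uniform neighbourhood (K3-report-a2 §2: the a-priori quiet-window bound).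
Size: XL.  rev 7 (lead c3 wave 3, worker K3): typed inputs RE-AUDITED and LANDED — `Theorems/…CompactnessToKerrInteriorDefs.lean`
(p163619: `K3Route.LeafCompactness'`, `CutEnergyLSC`, `CompetitorRealisation`, `BoxTransfer`, free base points, all existence
claims concentrated in `LeafCompactness'`) and the sorry-free reduction `stub_compactnessToKerrInterior_of_facts :
LeafCompactness' → CutEnergyLSC → CompetitorRealisation → BoxTransfer → <this signature>` (`…CompactnessToKerrInteriorReduction.lean`,
p164206); verdict `stub-blocked: K3Route.LeafCompactness'`.  Structural risk (R) recorded there: Arzelà–Ascoli limits are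
`C^{k'−1}`, the limit category is `C^∞`.  Sources: Ringstrom2009 Ch. 16, ChristodoulouKlainerman1993PMS41 Ch. 17, CzimekRodnianski2022,
KehleUnger2024EventHorizonGluing, DafermosLuk2017, DongSong2024. -/
theorem stub_compactnessToKerrInterior : ExactMinimiserKerrnessOriented →
    ∀ (χ m₀ : ℝ) (k₁ : ℕ) (ε₁ : ℝ≥0∞) (R T : ℝ), χ < 1 → 0 < m₀ → 0 < ε₁ →
    ∃ k' : ℕ, ∀ Λ : ℝ≥0∞, Λ < 1 → ∃ (δ : ℝ≥0∞) (γ : ℝ), 0 < δ ∧ 0 < γ ∧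
    ∀ (X : Type) [TopologicalSpace X] [ChartedSpace E3 X] [IsManifold (𝓡 3) ∞ X]
      [T2Space X] [SecondCountableTopology X] [ConnectedSpace X],
    ∀ D ∈ admissibleVacuumData X, ∀ (𝒟 : VacuumCauchyDevelopment D)
      (M a : Fin 1 → ℝ) (S : Set 𝒟.carrier) (p : 𝒟.carrier) (mo : Fin 1 → lorentzGroup × E4)
      (B : Fin 1 → ModelBackground) (Φ : ∀ i, (B i).domain → 𝒟.carrier),
    𝒟.IsMaximal → (∀ i, m₀ ≤ M i ∧ M i ≤ m₀⁻¹ ∧ |a i| ≤ χ * M i) →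
    IsPinnedSoundNearKerrLeaf 𝒟.toCauchyDevelopment k' Λ 1 M a S → p ∈ S →
    (∃ i, p ∈ Φ i '' (B i).truncTimeSlab (3 * M i) 0) → (mo 0).1 = 1 →
    𝒟.NearKerrCollarCore k' δ γ 1 M a S p mo B Φ →
    K2Route.CollarFutureOriented 𝒟 M mo B Φ → K2Route.CollarTimeOriented 𝒟 M a mo B Φ →
    ∃ (τ : ℝ) (Ψ : (B 0).domain → 𝒟.carrier),
      IsNearModelBox 𝒟.toSpacetime (B 0) k₁ ε₁ τ (τ + T) (M 0) (R + 1)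
        (𝒟.metric.causalFuture 𝒟.timeOrientation (collarCore M p B Φ)) Ψ := by
  sorry

/-- **K4 — FAR COMPLETION** (shared far-field engine, BOX form; rev 3: collar orientation clauses), RE-TYPED on
the hypothesis side after wave 1 exactly as K3 (pinned sound hypothesis leaf; rest-frame collar, hence a rest-frame box interface
with K3).  For every margin/window and target `(k, ε)` the far engine names the box it needs — quality
`(k₁, ε₁)`, radius `R`, LENGTH `T` — and a `k'`; then below the honesty threshold some `δ, γ > 0` make:
pinned-sound `(Λ, k')`-leaf `S ∋ p` through ONE rest-frame `δ`-Kerr thick collar containing `p`, core with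
a cut energy and gap `≤ γ`, PLUS an `(ε₁, k₁)`-Kerr box `{τ < t* < τ + T, M < r < R + 1}` inside `J⁺(C)`
⟹ a SOUND `(ε, k)`-near-Kerr leaf with the same `(M, a)` inside `J⁺(C)`.  Mechanism and status
(K4-report-a2): F1 recentring / box ⟹ near-zone layer — PROVED (`shiftTime_starBackground`, Kerr
stationarity), together with the 25-clause assembly `isSoundNearKerrLeaf_of_box_of_farChart` (box + far
chart with 17 explicit clauses ⟹ sound leaf `⊆ J⁺(C)`), published as
`Lines/direct-method-on-the-cone-K4.lean`; the remaining input is F2ʳ `FarHyperboloidalCompletionRest`: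
semi-global Cauchy-characteristic existence + decay near `𝓘⁺` RELATIVE TO KERR with small characteristic
but large interior data (Klainerman–Nicolò prove the Minkowski-relative exterior theorem; the Kerr version
is not in print), a Bondi-flux budget from the gap, and HF exclusion from the (now frame-honest) leaf
bound with `k' ≈ 3k`.  Parameter choices recorded in K4-report-a2 §4 (`ε₁ = ε/4`, `k₁ = k' = 3k + 4`,
`R = 8/(m₀ε') + 4/m₀ + 2`, `T = R + (4/m₀) log(R m₀) + 6`).  Why it might fail: the Kerr-relative
exterior stability statement is research-level (barrier `NullConditionFailure`, evasion (i)).  Size: XL.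
rev 7 (lead c3 wave 3, worker K4): LANDED `Theorems/…FarCompletionDefs.lean` (p164028: recentring, layer sets, `IsFarChart`,
`BoxTimeOriented`, typed input `FarHyperboloidalCompletionRest`, bridge `RestCollarBoxOriented`), `…FarCompletionAssembly.lean`
(p164368: the 25-clause assembly) and the sorry-free reduction `stub_farCompletion_of_facts : FarHyperboloidalCompletionRest →
RestCollarBoxOriented → <this signature>` (`…FarCompletionReduction.lean`, p164640); verdict `stub-blocked:
FarHyperboloidalCompletionRest`; polish suggested: thread `BoxTimeOriented` through the K2'/EMK/K3 box conclusions.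
Sources: KlainermanNicolo2003, Luk2012CharIVP, DafermosHolzegelRodnianskiTaylor2021,
ChristodoulouKlainerman1993PMS41 Ch. 17, DeviationTolerance.lean / SoundNearKerrLeaf.lean. -/
theorem stub_farCompletion : ∀ (χ m₀ : ℝ) (k : ℕ) (ε : ℝ≥0∞), χ < 1 → 0 < m₀ → 0 < ε →
    ∃ (k₁ : ℕ) (ε₁ : ℝ≥0∞) (R T : ℝ), 0 < ε₁ ∧ ∃ k' : ℕ, ∀ Λ : ℝ≥0∞, Λ < 1 →
    ∃ (δ : ℝ≥0∞) (γ : ℝ), 0 < δ ∧ 0 < γ ∧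
    ∀ (X : Type) [TopologicalSpace X] [ChartedSpace E3 X] [IsManifold (𝓡 3) ∞ X]
      [T2Space X] [SecondCountableTopology X] [ConnectedSpace X],
    ∀ D ∈ admissibleVacuumData X, ∀ (𝒟 : VacuumCauchyDevelopment D)
      (M a : Fin 1 → ℝ) (S : Set 𝒟.carrier) (p : 𝒟.carrier) (mo : Fin 1 → lorentzGroup × E4)
      (B : Fin 1 → ModelBackground) (Φ : ∀ i, (B i).domain → 𝒟.carrier),
    𝒟.IsMaximal → (∀ i, m₀ ≤ M i ∧ M i ≤ m₀⁻¹ ∧ |a i| ≤ χ * M i) →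
    IsPinnedSoundNearKerrLeaf 𝒟.toCauchyDevelopment k' Λ 1 M a S → p ∈ S →
    (∃ i, p ∈ Φ i '' (B i).truncTimeSlab (3 * M i) 0) → (mo 0).1 = 1 →
    𝒟.NearKerrCollarCore k' δ γ 1 M a S p mo B Φ →
    K2Route.CollarFutureOriented 𝒟 M mo B Φ → K2Route.CollarTimeOriented 𝒟 M a mo B Φ →
    (∃ (τ : ℝ) (Ψ : (B 0).domain → 𝒟.carrier),
      IsNearModelBox 𝒟.toSpacetime (B 0) k₁ ε₁ τ (τ + T) (M 0) (R + 1)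
        (𝒟.metric.causalFuture 𝒟.timeOrientation (collarCore M p B Φ)) Ψ) →
    ∃ S' : Set 𝒟.carrier, 𝒟.toCauchyDevelopment.IsSoundNearKerrLeaf k ε 1 M a S' ∧
      S' ⊆ 𝒟.metric.causalFuture 𝒟.timeOrientation (collarCore M p B Φ) := by
  sorry

/-! ## Foreign sector (N = 0, the probe point) -/

/-- **PROBE SECTOR of the repaired crux** (FOREIGN: verbatim what the registered stubs B1 → F3 → B2 of
line `hyperboloidal-mass-pinches-flat` compose to; stated here only so that the composition reaches the
filed decl).  Below the honesty threshold and above the trivial regime, a `(Λ, k')`-leaf `S ∋ p` without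
holes in an MGHD of admissible data whose cone cut at `p` has an energy and Bondi–Bartnik gap `≤ γ` is
followed by an `(ε, k)`-flat leaf in `J⁺(S)`.  THIS line's own engine for the sector (a graft for the
lead, not a stub): the Bondi–Bartnik infimum of a point is `0` (B1), so the limit of a failing sequence is
an exact minimiser with `𝔅_∞ = 0`; Chruściel–Paetz positivity and RIGIDITY of the light-cone mass
(arXiv:1401.3789, p. 4: "suppose `m_TB` vanishes … `T_rr|_N = 0 = σ`. In vacuum this implies [CCG] that
the metric is flat to the future of the light-cone") give a FLAT `J⁺(p_∞)`, and K3/K4 (flat version)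
transfer back — a printed rigidity theorem in place of K1 ∧ K2.  Why it might fail (as the foreign line
states it): the escape window F3 (reaching an honest slice inside `J⁺(p)` past large escaping content) and
the frame bookkeeping of the engine B2.  Size: XL.  rev 7 (lead c3 wave 3, worker Probe): LANDED
`Theorems/…ProbeSectorDefs.lean` (p163387: B1 `ProbeRoute.ProbeBartnikMassZero`, F4 `ProbeRoute.ConeEnergyPinchesFlatSound`) and
the sorry-free reduction `stub_probeSector_of_facts : B1 → F4 → <this signature>` (`…ProbeSectorReduction.lean`, p163758);
verdict `stub-blocked: ProbeRoute.ProbeBartnikMassZero` (Lean-inert: no admissible MGHD with a round section family is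
constructible in the tree); no outright dodge-proof (the N = 0 leaf certifies one unweighted chart only).
Sources: arXiv:1401.3789, arXiv:0905.2133 [CCG], HirschKazarasKhuri2022, DongSong2024, KlainermanNicolo2003,
doi:10.1007/s00220-017-3005-8. -/
theorem stub_probeSector : ∀ (k : ℕ) (ε : ℝ≥0∞), 0 < ε →
    ∃ k' : ℕ, ∀ Λ : ℝ≥0∞, Λ < 1 → ε < Λ → ∃ γ : ℝ, 0 < γ ∧
    ∀ (X : Type) [TopologicalSpace X] [ChartedSpace E3 X] [IsManifold (𝓡 3) ∞ X]
      [T2Space X] [SecondCountableTopology X] [ConnectedSpace X],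
    ∀ D ∈ admissibleVacuumData X, ∀ (𝒟 : VacuumCauchyDevelopment D) (M a : Fin 0 → ℝ)
      (S : Set 𝒟.carrier) (p : 𝒟.carrier),
    𝒟.IsMaximal → 𝒟.toCauchyDevelopment.IsNearKerrLeaf k' Λ 0 M a S → p ∈ S →
    (∃ m : ℝ, 𝒟.toCauchyDevelopment.HasCutBondiMass ({p} : Set 𝒟.carrier) m) →
    𝒟.BondiBartnikGapLE ({p} : Set 𝒟.carrier) γ →
    ∃ S' : Set 𝒟.carrier, 𝒟.toCauchyDevelopment.IsNearKerrLeaf k ε 0 M a S' ∧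
      S' ⊆ 𝒟.metric.causalFuture 𝒟.timeOrientation S := by
  sorry

/-! ## Filed-text residue (not a lemma of the line) -/

/-- **FILED-TEXT RESIDUE — do not staff** (rev 2).  The sectors of the crux AS FILED (rev 2 of the Theses
file: `∀ Λ < ⊤`, any `N`, any `p ∈ S`, TYPED hypothesis leaf, arbitrarily framed collars) outside the
honest regime of this line: `1 ≤ Λ` (collapsed flat charts certify nothing,
`Spacetime.deviationCk_hypBackground_top_le`); `2 ≤ N` (seamed cores, Defect B/C); `N = 1` with `p` off
the collar (seamed again); and — NEW in rev 2, from the wave-1 verdicts on K3/K4 — `N = 1` with a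
hypothesis leaf that is not PINNED SOUND at the working regularity `k'`, or a collar chart that is not
REST-FRAME (`(mo' i).1 ≠ 1`) or not FUTURE-ORIENTED (rev 3, wave-2 verdicts on F1/F5: the thick-collar block
is orientation-blind on its own; white-hole collars satisfy it).  Stated for all sufficiently large `k'` (`∃ k₀ ∀ k' ≥ k₀`, so that the
composition hands over the negated pinned clause at its own `k'`); gap clause in the definitional form
`BondiBartnikGapLE`.  Status (crux NOTES item 6, DODGE-c2): junk-TRUE on paper in all four sectors
(dodging leaves + fake holes: the filed CONCLUSION is the typed leaf), FALSE given the unsupported `H` of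
the imported Negative lemma, Lean-undecidable either way; isolated so that the restatement — C″ plus SOUND
conclusion leaves plus, on the hypothesis side, PINNED SOUND leaves and REST-FRAME collars — deletes
exactly this stub.  Size: n/a. -/
theorem stub_filedTextResidue : ∀ (χ m₀ : ℝ) (N₀ k : ℕ) (ε : ℝ≥0∞), χ < 1 → 0 < m₀ → 0 < ε →
    ∃ k₀ : ℕ, ∀ k' : ℕ, k₀ ≤ k' → ∀ Λ : ℝ≥0∞, Λ < ⊤ → ε < Λ → ∃ (δ : ℝ≥0∞) (γ : ℝ), 0 < δ ∧ 0 < γ ∧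
    ∀ (X : Type) [TopologicalSpace X] [ChartedSpace E3 X] [IsManifold (𝓡 3) ∞ X]
      [T2Space X] [SecondCountableTopology X] [ConnectedSpace X],
    ∀ D ∈ admissibleVacuumData X, ∀ (𝒟 : VacuumCauchyDevelopment D) (N : ℕ)
      (M a : Fin N → ℝ) (S : Set 𝒟.carrier) (p : 𝒟.carrier) (mo' : Fin N → lorentzGroup × E4)
      (B' : Fin N → ModelBackground) (Φ : ∀ i, (B' i).domain → 𝒟.carrier),
    (1 ≤ Λ ∨ 2 ≤ N ∨ (N = 1 ∧ ∀ i, p ∉ Φ i '' (B' i).truncTimeSlab (3 * M i) 0) ∨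
      (N = 1 ∧ ¬ (IsPinnedSoundNearKerrLeaf 𝒟.toCauchyDevelopment k' Λ N M a S ∧
        (∀ i, (mo' i).1 = 1) ∧ K2Route.CollarFutureOriented 𝒟 M mo' B' Φ ∧
        K2Route.CollarTimeOriented 𝒟 M a mo' B' Φ))) →
    𝒟.IsMaximal → N ≤ N₀ → (∀ i, m₀ ≤ M i ∧ M i ≤ m₀⁻¹ ∧ |a i| ≤ χ * M i) →
    𝒟.toCauchyDevelopment.IsNearKerrLeaf k' Λ N M a S → p ∈ S →
    (∀ i, B' i = starBackground (mo' i).1 (mo' i).2 (M i) (a i)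
      (fun x => Kerr.radius (a i) (poincareInv (mo' i).1 (mo' i).2 x))) →
    (∀ i, ContMDiffOn 𝓘(ℝ, E4) (𝓡 4) ∞ (Φ i)
        {x | -1 < (B' i).time x.1 ∧ (B' i).time x.1 < 1 ∧ (B' i).radius x.1 < 3 * M i + 1} ∧
      Topology.IsOpenEmbedding ({x | -1 < (B' i).time x.1 ∧ (B' i).time x.1 < 1 ∧
        (B' i).radius x.1 < 3 * M i + 1}.restrict (Φ i))) →
    (∀ i, 𝒟.toSpacetime.truncDeviationCk (B' i) (Φ i) k' (3 * M i) 0 ≤ δ) →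
    (∀ i, Φ i '' (B' i).truncTimeSlab (3 * M i) 0 ⊆ S) →
    Pairwise (Function.onFun Disjoint fun i => Φ i '' (B' i).truncTimeSlab (3 * M i) 0) →
    (∃ m : ℝ, 𝒟.toCauchyDevelopment.HasCutBondiMass
      ({p} ∪ ⋃ i, Φ i '' (B' i).truncTimeSlab (3 * M i) 0) m) →
    𝒟.BondiBartnikGapLE ({p} ∪ ⋃ i, Φ i '' (B' i).truncTimeSlab (3 * M i) 0) γ →
    ∃ S' : Set 𝒟.carrier, 𝒟.toCauchyDevelopment.IsNearKerrLeaf k ε N M a S' ∧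
      S' ⊆ 𝒟.metric.causalFuture 𝒟.timeOrientation S := by
  sorry

/-! ## Composition -/

/-- **The line closes the crux** (pure logic, sorry-free outside the stubs).  `k'` is the maximum of
the stubs' derivative counts (and `k`, and the residue's threshold), `δ`/`γ` the minima of their
tolerances at the given `Λ`; regimes: `Λ ≤ ε` — the landed trivial regime (p103152); `ε < Λ < 1` — by
cases on `N`: `N = 0` is the foreign probe sector, `N = 1` with `p` in the collar, a PINNED SOUND
hypothesis leaf at level `k'` and a REST-FRAME collar is THIS LINE (`exactMinimiserKerrness_of_stubs` =
K1 ∘ K2, fed to K3 at the box parameters K4 asked for; K4 turns the box into a SOUND leaf inside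
`J⁺(C) ⊆ J⁺(S)`, and sound leaves are typed leaves), everything else is the filed-text residue;
`1 ≤ Λ` — residue. -/
theorem BondiBartnikRigidity_of :
    Summit.FinalStateConjecture.FinalStateConjecture.Theses.BartnikGapSettling.BondiBartnikRigidity := by
  intro χ m₀ N₀ k ε hχ hm₀ hε
  -- derivative counts and box parameters of the stubs
  obtain ⟨kᵣ, hR⟩ := stub_filedTextResidue χ m₀ N₀ k ε hχ hm₀ hε
  obtain ⟨k₀, hP⟩ := stub_probeSector k ε hε
  obtain ⟨k₁, ε₁, R, T, hε₁, k₄, hF⟩ := stub_farCompletion χ m₀ k ε hχ hm₀ hε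
  obtain ⟨k₃, hI⟩ := stub_compactnessToKerrInterior exactMinimiserKerrnessOriented_of_stubs χ m₀ k₁ ε₁ R T
    hχ hm₀ hε₁
  set k' : ℕ := max (max k kᵣ) (max k₀ (max k₃ k₄)) with hk'
  have hkk' : k ≤ k' := by omega
  have hkᵣ : kᵣ ≤ k' := by omega
  have hk₀ : k₀ ≤ k' := by omega
  have hk₃ : k₃ ≤ k' := by omega
  have hk₄ : k₄ ≤ k' := by omega
  -- the residue at the working regularity `k'`
  have hR := hR k' hkᵣ
  refine ⟨k', fun Λ hΛ => ?_⟩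
  by_cases hΛε : Λ ≤ ε
  · -- trivial regime: the hypothesis leaf itself (landed, p103152)
    refine ⟨1, 1, one_pos, one_pos, ?_⟩
    intro X _ _ _ _ _ _ D hD 𝒟 N M a S p mo' B' Φ hmax hN hwin hleaf hp hB hΦ hdev hsub hdis hcut
      hgap
    exact Summit.FinalStateConjecture.FinalStateConjecture.Theorems.stub_trivialRegime k k' ε Λ hkk'
      hΛε X D 𝒟 N M a S hleaf
  · have hεΛ : ε < Λ := lt_of_not_ge hΛε
    obtain ⟨δᵣ, γᵣ, hδᵣ, hγᵣ, hR'⟩ := hR Λ hΛ hεΛ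
    rcases lt_or_ge Λ 1 with hΛ1 | hΛ1
    · -- honest regime `ε < Λ < 1`
      obtain ⟨γ₀, hγ₀, hP'⟩ := hP Λ hΛ1 hεΛ
      obtain ⟨δ₃, γ₃, hδ₃, hγ₃, hI'⟩ := hI Λ hΛ1
      obtain ⟨δ₄, γ₄, hδ₄, hγ₄, hF'⟩ := hF Λ hΛ1
      set γs : ℝ := min (min γ₀ γ₃) (min γ₄ γᵣ) with hγs
      have hγs0 : 0 < γs := lt_min (lt_min hγ₀ hγ₃) (lt_min hγ₄ hγᵣ)
      have hγs₀ : γs ≤ γ₀ := (min_le_left _ _).trans (min_le_left _ _)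
      have hγs₃ : γs ≤ γ₃ := (min_le_left _ _).trans (min_le_right _ _)
      have hγs₄ : γs ≤ γ₄ := (min_le_right _ _).trans (min_le_left _ _)
      have hγsᵣ : γs ≤ γᵣ := (min_le_right _ _).trans (min_le_right _ _)
      set δ : ℝ≥0∞ := min δ₃ (min δ₄ δᵣ) with hδ
      have hδ0 : 0 < δ := lt_min hδ₃ (lt_min hδ₄ hδᵣ)
      have hδδ₃ : δ ≤ δ₃ := min_le_left _ _
      have hδδ₄ : δ ≤ δ₄ := (min_le_right _ _).trans (min_le_left _ _)
      have hδδᵣ : δ ≤ δᵣ := (min_le_right _ _).trans (min_le_right _ _)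
      refine ⟨δ, γs, hδ0, hγs0, ?_⟩
      intro X _ _ _ _ _ _ D hD 𝒟 N M a S p mo' B' Φ hmax hN hwin hleaf hp hB hΦ hdev hsub hdis hcut
        hgap
      -- monotonicity of the collar closeness in `δ` (at the working regularity)
      have hdev_of : ∀ {dd : ℝ≥0∞}, δ ≤ dd →
          ∀ i, 𝒟.toSpacetime.truncDeviationCk (B' i) (Φ i) k' (3 * M i) 0 ≤ dd := by
        intro dd hdd i
        exact (hdev i).trans hdd
      -- the gap clause in its definitional form, and its monotonicity in `γ`
      have hgap' : 𝒟.BondiBartnikGapLE ({p} ∪ ⋃ i, Φ i '' (B' i).truncTimeSlab (3 * M i) 0) γs :=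
        hgap
      -- case split on the number of holes
      rcases N with _ | _ | n
      · -- N = 0: the foreign probe sector
        have hC0 : ({p} ∪ ⋃ i, Φ i '' (B' i).truncTimeSlab (3 * M i) 0) = ({p} : Set 𝒟.carrier) := by
          simp
        rw [hC0] at hgap' hcut
        exact hP' X D hD 𝒟 M a S p hmax (hleaf.mono hk₀ le_rfl) hp hcut (hgap'.mono hγs₀)
      · -- N = 1: THIS LINE when `p` is in the collar, the hypothesis leaf is pinned sound at level `k'`
        -- and the collar is rest-frame; residue otherwise
        by_cases hpc : ∃ i, p ∈ Φ i '' (B' i).truncTimeSlab (3 * M i) 0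
        · by_cases hps : IsPinnedSoundNearKerrLeaf 𝒟.toCauchyDevelopment k' Λ 1 M a S ∧
              (∀ i, (mo' i).1 = 1) ∧ K2Route.CollarFutureOriented 𝒟 M mo' B' Φ ∧
              K2Route.CollarTimeOriented 𝒟 M a mo' B' Φ
          · -- the thick-collar block of the instance
            have hcore : 𝒟.NearKerrCollarCore k' δ γs 1 M a S p mo' B' Φ :=
              ⟨hB, hΦ, hdev, hsub, hdis, hcut, hgap⟩
            -- K3 (fed K1 ∘ K2): the box the far engine asked for
            obtain ⟨τ, Ψ, hbox⟩ := hI' X D hD 𝒟 M a S p mo' B' Φ hmax hwin (hps.1.mono hk₃ le_rfl) hp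
              hpc (hps.2.1 0) (hcore.mono hk₃ hδδ₃ hγs₃) hps.2.2.1 hps.2.2.2
            -- K4: the sound leaf inside `J⁺(C)`
            obtain ⟨S', hS', hS'C⟩ := hF' X D hD 𝒟 M a S p mo' B' Φ hmax hwin (hps.1.mono hk₄ le_rfl)
              hp hpc (hps.2.1 0) (hcore.mono hk₄ hδδ₄ hγs₄) hps.2.2.1 hps.2.2.2 ⟨τ, Ψ, hbox⟩
            -- sound ⇒ typed; `J⁺(C) ⊆ J⁺(S)` since `C ⊆ S`
            exact ⟨S', hS'.isNearKerrLeaf, hS'C.trans (LorentzianMetric.causalFuture_mono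
              (Literature.Geometry.Lorentzian.collarCore_subset M p B' Φ hp hsub))⟩
          · exact hR' X D hD 𝒟 _ M a S p mo' B' Φ (Or.inr (Or.inr (Or.inr ⟨rfl, hps⟩))) hmax hN hwin
              hleaf hp hB hΦ (hdev_of hδδᵣ) hsub hdis hcut (hgap'.mono hγsᵣ)
        · push Not at hpc
          exact hR' X D hD 𝒟 _ M a S p mo' B' Φ (Or.inr (Or.inr (Or.inl ⟨rfl, hpc⟩))) hmax hN hwin
            hleaf hp hB hΦ (hdev_of hδδᵣ) hsub hdis hcut (hgap'.mono hγsᵣ)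
      · -- N ≥ 2: residue (seamed / stacked cores)
        exact hR' X D hD 𝒟 (n + 2) M a S p mo' B' Φ (Or.inr (Or.inl (by omega))) hmax hN hwin
          hleaf hp hB hΦ (hdev_of hδδᵣ) hsub hdis hcut (hgap'.mono hγsᵣ)
    · -- junk-chart regime `1 ≤ Λ`: filed-text residue
      refine ⟨δᵣ, γᵣ, hδᵣ, hγᵣ, ?_⟩
      intro X _ _ _ _ _ _ D hD 𝒟 N M a S p mo' B' Φ hmax hN hwin hleaf hp hB hΦ hdev hsub hdis hcut
        hgap
      exact hR' X D hD 𝒟 N M a S p mo' B' Φ (Or.inl hΛ1) hmax hN hwin hleaf hp hB hΦ hdev hsub hdis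
        hcut hgap

/-- The landed Negative lemma of this crux is in scope (checked against; it concerns only the residue
stub, modulo its unsupported construction hypothesis `H`). -/
example : Theorems.BondiBartnikRigidity.Negative.BlindCollapsedLeafExists →
    ¬ Summit.FinalStateConjecture.FinalStateConjecture.Theses.BartnikGapSettling.BondiBartnikRigidity :=
  Theorems.BondiBartnikRigidity.Negative.BondiBartnikRigidity_false_of_blindCollapsedLeafExists

end Summit.FinalStateConjecture.FinalStateConjecture.Cruxes.BondiBartnikRigidity.DirectMethodOnTheCone

end
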